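import Summits.BirchSwinnertonDyer.BirchSwinnertonDyer.Theorems.ByReductionTypeAtTwoTorsionEulerCharGoodOrdUpper
import HarnessLib

set_option linter.dupNamespace false -- `…BirchSwinnertonDyer.BirchSwinnertonDyer…` is the cell's nested layout (D-0017)
set_option autoImplicit false

/-!
# Route `ByReductionTypeAtTwo`, item `OrdKatoHalfAtTwo` (stmt-BirchSwinnertonDyer-19271), GOOD ORDINARY `2`: the UPPER-HALF
# DOORS `MissingUpperBoundAt W 2` WITHOUT the PRINT binder `hEC : X5.O1.TwoAdicEulerCharRankZero W 0` — road (i) `μ = 0`,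
# the TOWER road, and THE α-go LINE (Greenberg Prop. 5.14 locus), rational `2`-torsion ALLOWED

Cell `bsd-2adic` (run/shared/lean/pub/bsd-2adic/), seat `bsd-2adic-tower-1` GEN 32; `--supports stmt-BirchSwinnertonDyer-19271`.
THEOREMS ONLY (no definition, no named fact, no `sorry`); closes no item; nothing booked; no display re-keyed (D-0152); BSD is
not proved by any of this.

The b2b-bsdres class-O1 doors `X5.O1.missingUpperBoundAt_two_of_mu_eq_zero(_auto)`, `…_of_towerGap`, `…_of_prop514(_auto)`
display `hEC : X5.O1.TwoAdicEulerCharRankZero W 0` (Greenberg LNM 1716 Thm. 4.1 at `2`, unit version) — KERNEL only on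
{`E(ℚ)[2] = 0`} (GEN 25), PRINT at every curve with a rational `2`-torsion point, i.e. on the whole α-go habitat these doors serve.
They consume only the upper-half direction, which is KERNEL for every good-ordinary-at-`2` curve (part A
`TorsionEulerChar.charValue_rankZero_upper_two`, `e ∈ ℤ₂ ∖ {0}`); the one-sided chain is part B
(`TorsionEulerChar.upperBound_two_le_of_mu_eq_zero`). This file re-assembles the doors on it:

* **`missingUpperBoundAt_two_goodOrd_of_mu_eq_zero(_auto)`** — per curve: rank `0`, `GoodOrd W 2`, modularity, GZK, Kato 17.4
  (1)(2)@2 (`h17`), `μ = 0` for the cyclotomic data, the Néron-integrality certificate `hint` (resp. `hper₀ : 0 ≤ ord₂ ϖ`,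
  INT2-AUTO) ⟹ `MissingUpperBoundAt W 2` — twin of `X5.O1.missingUpperBoundAt_two_of_mu_eq_zero(_auto)` with `hEC` DISCHARGED;
* **`missingUpperBoundAt_two_goodOrd_of_towerGap(_auto)`** — the TOWER road per member (tower-gap certificate ⟹ `μ₂ = 0`, T10),
  NO `hEC`;
* **`missingUpperBoundAt_two_goodOrd_of_prop514(_auto)`** — THE α-go LINE: a rational `2`-torsion point ramified-at-`2` XOR odd
  (`h514` PRINT ⟹ `X` torsion ∧ `μ₂ = 0`), NO `hEC` — precisely the members WITH rational `2`-torsion that GEN 25's kernel `hEC`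
  could not serve (83 good-ordinary rank-`0` X5 classes, refuter census `O1D-GREENBERG-L1.tsv`, EVIDENCE).

HONEST FRAMING: assembly over tree theorems; remaining displayed inputs = PRINT {`h17`, modularity, GZK, `h514`} + certificates
{`hint`/`hper₀`, `μ = 0`/tower gap}; the LOWER half (`MissingLowerBoundAt W 2`) is untouched; closes no item; no summit statement
is proved; the Birch–Swinnerton-Dyer conjecture is NOT proved by any of this.

References: [GreenbergLNM1716] Thm. 4.1 (p. 102), Prop. 5.14 (p. 121); [MazurTateTeitelbaum1986Invent] §I.12;
[Kato2004Asterisque] Thm. 17.4 (1)(2) (p. 273); [Miller2011LMS] Def. 1.1; [Washington1997] §13.2.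
-/

noncomputable section

open scoped Classical MatrixGroups ModularForm

open NumberField IsDedekindDomain CongruenceSubgroup WeierstrassCurve Literature.NumberTheory.EllipticCurves
  Literature.NumberTheory.EllipticCurves.ModularForms
  Literature.NumberTheory.EllipticCurves.Greenberg1999
  Literature.NumberTheory.EllipticCurves.Wuthrich2014
  Literature.NumberTheory.EllipticCurves.Rank1Residual
  Literature.NumberTheory.EllipticCurves.Rank1Residual.Typed
  Summit.BirchSwinnertonDyer.Rank1Residual.X5 Summit.BirchSwinnertonDyer.Rank1Residual.X5.O1

namespace Summit.BirchSwinnertonDyer.BirchSwinnertonDyer.Theorems.TorsionEulerChar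

section PerMember

variable (W : WeierstrassCurve ℚ) [W.IsElliptic] [W.IsGloballyMinimal]

/-! ## §3 The doors without `hEC` -/

/-- **`MissingUpperBoundAt W 2` from `μ₂(X(E/ℚ_∞)) = 0`, per curve, SHARP, NO `hEC`, rational `2`-torsion ALLOWED.** Rank `0`
(`hr`), `GoodOrd W 2` (`hgo`); PRINT: modularity (`hmod`), GZK (`hGZK`), Kato 17.4 (1)(2)@2 for the newform at level `N_E`
(`h17`); certificates: `μ = 0` for the cyclotomic data (`hμ`) and the Néron-integrality `ϖ · L₂(f, α) ∈ Λ` (`hint`). Twin of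
`X5.O1.missingUpperBoundAt_two_of_mu_eq_zero` with Greenberg's Thm. 4.1@2 (`hEC`) DISCHARGED by part A.
[cite: Kato2004Asterisque, Thm. 17.4 (1)(2) (p. 273)] [cite: Miller2011LMS, Def. 1.1] [cite: GreenbergLNM1716, Thm. 4.1 (p. 102)] -/
theorem missingUpperBoundAt_two_goodOrd_of_mu_eq_zero (hmod : nonempty_modularParametrizationData)
    (hGZK : rank_eq_analyticRank_of_analyticRank_le_one)
    (h17 : ∀ [NeZero (W.conductorNorm ℤ)] (f : CuspForm (Gamma0 (W.conductorNorm ℤ)) 2),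
      kato_divisibility_allPrimes W 2 (f := f))
    (hμ : ∀ (κ : ZpExtension ℚ 2) (γ : Field.absoluteGaloisGroup ℚ), κ.IsCyclotomic →
      κ.IsTopGenerator γ → IsCyclotomicVariable 2 γ → ∀ D : W.SelmerDualData κ γ, D.mu = 0)
    (hint : ∀ [NeZero (W.conductorNorm ℤ)] (f : CuspForm (Gamma0 (W.conductorNorm ℤ)) 2),
      IsNewformOf W f → ∀ ϖ : ℚ, (ϖ : ℝ) * W.realPeriodRat = plusPeriod f →
        ∃ L₀ : IwasawaAlgebra 2, iwasawaToPowerSeries 2 L₀ =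
          PowerSeries.C (ϖ : ℚ_[2]) * padicLFunction f (unitRoot W 2 : ℚ_[2]))
    (hr : W.analyticRank = 0) (hgo : GoodOrd W 2) : MissingUpperBoundAt W 2 := by
  -- adapted from `X5.O1.missingUpperBoundAt_two_of_mu_eq_zero` (cell b2b-bsdres)
  have hord : IsOrdinaryAt W 2 := hgo
  haveI : NeZero (W.conductorNorm ℤ) := ⟨(W.conductorNorm_pos_holds).ne'⟩
  obtain ⟨Dm⟩ := hmod W
  have hf : IsNewformOf W Dm.f := Dm.isNewformOf
  have hL : W.entireLFunction 1 ≠ 0 :=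
    (W.analyticRank_eq_zero_iff_holds hf.hasEntireLFunction).mp hr
  obtain ⟨ϖ, hϖpos, hϖeq, -⟩ := Dm.exists_rat_mul_realPeriodRat_eq_plusPeriod
  obtain ⟨κ, hκ, γ, hγ, hγ'⟩ := exists_isCyclotomic_isTopGenerator_isCyclotomicVariable_holds 2
  obtain ⟨D⟩ := W.nonempty_selmerDualData_holds κ γ hγ
  obtain ⟨L₀, hL₀⟩ := hint Dm.f hf ϖ hϖeq
  obtain ⟨q, hq, hle⟩ := upperBound_two_le_of_mu_eq_zero W hGZK hord hL (h17 Dm.f) hκ hγ hγ' hf D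
    (hμ κ γ hκ hγ hγ' D) ϖ hϖeq hϖpos.ne' 0 (by simp) hL₀
  exact ⟨q, hq, by simpa using hle⟩

/-- **The same with the certificate `hint` discharged by INT2-AUTO down to `hper₀ : 0 ≤ ord₂ ϖ`** (twin of
`X5.O1.missingUpperBoundAt_two_of_mu_eq_zero_auto`, NO `hEC`). [cite: Kato2004Asterisque, Thm. 17.4 (1)(2) (p. 273)]
[cite: MazurTateTeitelbaum1986Invent, §I.12] [cite: Miller2011LMS, Def. 1.1] -/
theorem missingUpperBoundAt_two_goodOrd_of_mu_eq_zero_auto (hmod : nonempty_modularParametrizationData)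
    (hGZK : rank_eq_analyticRank_of_analyticRank_le_one)
    (h17 : ∀ [NeZero (W.conductorNorm ℤ)] (f : CuspForm (Gamma0 (W.conductorNorm ℤ)) 2),
      kato_divisibility_allPrimes W 2 (f := f))
    (hμ : ∀ (κ : ZpExtension ℚ 2) (γ : Field.absoluteGaloisGroup ℚ), κ.IsCyclotomic →
      κ.IsTopGenerator γ → IsCyclotomicVariable 2 γ → ∀ D : W.SelmerDualData κ γ, D.mu = 0)
    (hper₀ : ∀ [NeZero (W.conductorNorm ℤ)] (f : CuspForm (Gamma0 (W.conductorNorm ℤ)) 2),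
      IsNewformOf W f → ∀ ϖ : ℚ, (ϖ : ℝ) * W.realPeriodRat = plusPeriod f → 0 ≤ padicValRat 2 ϖ)
    (hr : W.analyticRank = 0) (hgo : GoodOrd W 2) : MissingUpperBoundAt W 2 :=
  missingUpperBoundAt_two_goodOrd_of_mu_eq_zero W hmod hGZK h17 hμ
    (fun f hf ϖ hϖ =>
      exists_integral_mul_padicLFunction_two_of_padicValRat_nonneg W hgo hf (hper₀ f hf ϖ hϖ))
    hr hgo

/-- **THE TOWER ROAD per member at a GOOD ORDINARY `2`, NO `hEC`, rational `2`-torsion ALLOWED** (twin of U10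
`X5.O1.missingUpperBoundAt_two_of_towerGap`): rank `0`, `GoodOrd W 2`, modularity, GZK, Kato 17.4 (1)(2)@2, the tower-gap
certificate `X5.O1.TowerGapAtTwo W` (⟹ `μ₂ = 0` for the cyclotomic data, T10) and the Néron-integrality certificate `hint` ⟹
`MissingUpperBoundAt W 2`. [cite: Washington1997, §13.2] [cite: Kato2004Asterisque, Thm. 17.4 (1)(2) (p. 273)]
[cite: Miller2011LMS, Def. 1.1] -/
theorem missingUpperBoundAt_two_goodOrd_of_towerGap (hmod : nonempty_modularParametrizationData)
    (hGZK : rank_eq_analyticRank_of_analyticRank_le_one)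
    (h17 : ∀ [NeZero (W.conductorNorm ℤ)] (f : CuspForm (Gamma0 (W.conductorNorm ℤ)) 2),
      kato_divisibility_allPrimes W 2 (f := f))
    (hgap : TowerGapAtTwo W)
    (hint : ∀ [NeZero (W.conductorNorm ℤ)] (f : CuspForm (Gamma0 (W.conductorNorm ℤ)) 2),
      IsNewformOf W f → ∀ ϖ : ℚ, (ϖ : ℝ) * W.realPeriodRat = plusPeriod f →
        ∃ L₀ : IwasawaAlgebra 2, iwasawaToPowerSeries 2 L₀ =
          PowerSeries.C (ϖ : ℚ_[2]) * padicLFunction f (unitRoot W 2 : ℚ_[2]))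
    (hr : W.analyticRank = 0) (hgo : GoodOrd W 2) : MissingUpperBoundAt W 2 :=
  missingUpperBoundAt_two_goodOrd_of_mu_eq_zero W hmod hGZK h17
    (fun _ _ hκ hγ hγ' D => (isTorsion_and_mu_eq_zero_of_towerGapAtTwo W hgap hκ hγ hγ' D).2)
    hint hr hgo

/-- **THE TOWER ROAD per member, certificate `hint` discharged by `hper₀ : 0 ≤ ord₂ ϖ`, NO `hEC`.**
[cite: Washington1997, §13.2] [cite: MazurTateTeitelbaum1986Invent, §I.12] [cite: Miller2011LMS, Def. 1.1] -/
theorem missingUpperBoundAt_two_goodOrd_of_towerGap_auto (hmod : nonempty_modularParametrizationData)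
    (hGZK : rank_eq_analyticRank_of_analyticRank_le_one)
    (h17 : ∀ [NeZero (W.conductorNorm ℤ)] (f : CuspForm (Gamma0 (W.conductorNorm ℤ)) 2),
      kato_divisibility_allPrimes W 2 (f := f))
    (hgap : TowerGapAtTwo W)
    (hper₀ : ∀ [NeZero (W.conductorNorm ℤ)] (f : CuspForm (Gamma0 (W.conductorNorm ℤ)) 2),
      IsNewformOf W f → ∀ ϖ : ℚ, (ϖ : ℝ) * W.realPeriodRat = plusPeriod f → 0 ≤ padicValRat 2 ϖ)
    (hr : W.analyticRank = 0) (hgo : GoodOrd W 2) : MissingUpperBoundAt W 2 :=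
  missingUpperBoundAt_two_goodOrd_of_mu_eq_zero_auto W hmod hGZK h17
    (fun _ _ hκ hγ hγ' D => (isTorsion_and_mu_eq_zero_of_towerGapAtTwo W hgap hκ hγ hγ' D).2)
    hper₀ hr hgo

/-- **THE α-go LINE — `MissingUpperBoundAt W 2` on the Greenberg Prop. 5.14 locus, NO `hEC`.** Rank `0`, `GoodOrd W 2`, a
rational point `(x, y)` of order `2` that is ramified-at-`2` XOR odd (`h514` PRINT gives `X` torsion and `μ₂ = 0` for every
cyclotomic datum); PRINT {Greenberg 5.14@2 `h514`, modularity, GZK, Kato 17.4 (1)(2)@2 `h17`} + the certificate `hint` ⟹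
`ord₂ #Ш ≤ ord₂ #Ш_an`. Twin of `X5.O1.missingUpperBoundAt_two_of_prop514` with `hEC` DISCHARGED — on the 83-class α-go habitat
(refuter census `O1D-GREENBERG-L1.tsv`, EVIDENCE) every member HAS rational `2`-torsion, so this is exactly where GEN 25's kernel
`hEC` (`E(ℚ)[2] = 0`) did not apply. [cite: GreenbergLNM1716, Prop. 5.14 (p. 121) and Thm. 4.1 (p. 102)]
[cite: Kato2004Asterisque, Thm. 17.4 (1)(2) (p. 273)] [cite: Miller2011LMS, Def. 1.1] -/
theorem missingUpperBoundAt_two_goodOrd_of_prop514 (h514 : prop514_isTorsion_mu_eq_zero_two)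
    (hmod : nonempty_modularParametrizationData)
    (hGZK : rank_eq_analyticRank_of_analyticRank_le_one)
    (h17 : ∀ [NeZero (W.conductorNorm ℤ)] (f : CuspForm (Gamma0 (W.conductorNorm ℤ)) 2),
      kato_divisibility_allPrimes W 2 (f := f))
    (hint : ∀ [NeZero (W.conductorNorm ℤ)] (f : CuspForm (Gamma0 (W.conductorNorm ℤ)) 2),
      IsNewformOf W f → ∀ ϖ : ℚ, (ϖ : ℝ) * W.realPeriodRat = plusPeriod f →
        ∃ L₀ : IwasawaAlgebra 2, iwasawaToPowerSeries 2 L₀ =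
          PowerSeries.C (ϖ : ℚ_[2]) * padicLFunction f (unitRoot W 2 : ℚ_[2]))
    (hr : W.analyticRank = 0) (hgo : GoodOrd W 2) {x y : ℚ} (hP : W.toAffine.Equation x y)
    (h2 : 2 * y + W.a₁ * x + W.a₃ = 0)
    (hΦ : (TwoTorsionRamifiedAtTwo x ∧ ¬ TwoTorsionOdd W x) ∨
      (TwoTorsionOdd W x ∧ ¬ TwoTorsionRamifiedAtTwo x)) : MissingUpperBoundAt W 2 :=
  missingUpperBoundAt_two_goodOrd_of_mu_eq_zero W hmod hGZK h17
    (fun _ _ hκ hγ _ D => (isTorsion_and_mu_eq_zero_of_prop514 W h514 hgo hP h2 hΦ hκ hγ D).2)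
    hint hr hgo

/-- **THE α-go LINE with the certificate discharged by `hper₀ : 0 ≤ ord₂ ϖ`, NO `hEC`** (twin of
`X5.O1.missingUpperBoundAt_two_of_prop514_auto`). [cite: GreenbergLNM1716, Prop. 5.14 (p. 121)]
[cite: Kato2004Asterisque, Thm. 17.4 (1)(2) (p. 273)] [cite: MazurTateTeitelbaum1986Invent, §I.12] -/
theorem missingUpperBoundAt_two_goodOrd_of_prop514_auto (h514 : prop514_isTorsion_mu_eq_zero_two)
    (hmod : nonempty_modularParametrizationData)
    (hGZK : rank_eq_analyticRank_of_analyticRank_le_one)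
    (h17 : ∀ [NeZero (W.conductorNorm ℤ)] (f : CuspForm (Gamma0 (W.conductorNorm ℤ)) 2),
      kato_divisibility_allPrimes W 2 (f := f))
    (hper₀ : ∀ [NeZero (W.conductorNorm ℤ)] (f : CuspForm (Gamma0 (W.conductorNorm ℤ)) 2),
      IsNewformOf W f → ∀ ϖ : ℚ, (ϖ : ℝ) * W.realPeriodRat = plusPeriod f → 0 ≤ padicValRat 2 ϖ)
    (hr : W.analyticRank = 0) (hgo : GoodOrd W 2) {x y : ℚ} (hP : W.toAffine.Equation x y)
    (h2 : 2 * y + W.a₁ * x + W.a₃ = 0)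
    (hΦ : (TwoTorsionRamifiedAtTwo x ∧ ¬ TwoTorsionOdd W x) ∨
      (TwoTorsionOdd W x ∧ ¬ TwoTorsionRamifiedAtTwo x)) : MissingUpperBoundAt W 2 :=
  missingUpperBoundAt_two_goodOrd_of_prop514 W h514 hmod hGZK h17
    (fun f hf ϖ hϖ =>
      exists_integral_mul_padicLFunction_two_of_padicValRat_nonneg W hgo hf (hper₀ f hf ϖ hϖ))
    hr hgo hP h2 hΦ

end PerMember

end Summit.BirchSwinnertonDyer.BirchSwinnertonDyer.Theorems.TorsionEulerChar

end
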